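import Summits.CriticalPhenomena.PercolationContinuityZ3.Theorems.Transplant.PlanarSkeletonFrmQuasiDefs
import Summits.CriticalPhenomena.PercolationContinuityZ3.Theorems.Transplant.SkelFrmQuasiBParamsBridgeF
import Summits.CriticalPhenomena.PercolationContinuityZ3.Theorems.Transplant.SkelFrmBParamsBridgeF
import Summits.CriticalPhenomena.PercolationContinuityZ3.Theorems.Transplant.SkelPhiRootBridgeData
import Summits.CriticalPhenomena.PercolationContinuityZ3.Theorems.Transplant.SkelFrmQuasi1ParamsLBL
import Summits.CriticalPhenomena.PercolationContinuityZ3.Theorems.Transplant.SkelFrmQuasi1ParamsPO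
import Summits.CriticalPhenomena.PercolationContinuityZ3.Theorems.Transplant.SkelFrmQuasiBChoiceNums
import Summits.CriticalPhenomena.PercolationContinuityZ3.Theorems.Transplant.SkelFrmQuasiBParamsLF
import Summits.CriticalPhenomena.PercolationContinuityZ3.Theorems.Transplant.SkelFrmQuasi1SlotTypes
import HarnessLib
import Summits.CriticalPhenomena.PercolationContinuityZ3.Theorems.Transplant.SkelFrmBParamsBridge0
/-!
# GEN-Q PORT (WAVE-Q table v0.8 section 2, row G110, U-level L14; captain R-6/R-7 2026-08-27: carrier token swap `PlanarSkeletonFrmFrom ↦ PlanarSkeletonFrmQuasi`)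
# of the tree module «Transplant/SkelFrmFromBParamsBridge0» (sha256 52f591b4d950a7a2…) onto the quasi-step carrier `PlanarSkeletonFrmQuasi` (p507026): «SkelFrmQuasiBParamsBridge0»

ORIGINAL TITLE: N2 (frames-only node `SamePDropOfSkeletonFrmFrom₁`, OPEN), (R) value layer — part Bridge0: **THE ROOT BRIDGE PAIR AND ITS FRAME AT THE (S0) KIT LEVELS**

builds on p205010 (kernel theorem, internal audit signed; external expert review pending) — nothing in this file uses p205010; NOTHING is claimed about any open node
((N3-b), the end state).  Lane `prim-bschramm`, seat `prim-hp-8` (gen 62; GEN-Q pen, family BChoiceRoot*/1Root*/BParamsKit·Bridge; tool = captain gen-1 g4's port_genq.py R-14 + p3-g30 T1/T2 + stmt-g33 --force-keep).  Helper file (`--supports stmt-CriticalPhenomena-4575 --as helper`).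
PORT RULES (U-wave r1–r4 re-used, GEN-Q hunk classes of p3-g29 #6136): declaration order, names and proof texts are those of «SkelFrmFromBParamsBridge0», byte-identical except
(i) the carrier token `PlanarSkeletonFrmFrom ↦ PlanarSkeletonFrmQuasi` in binders, `namespace`/`end` lines and qualified names (module names `SkelFrmFrom… ↦ SkelFrmQuasi…`
in imports of already-ported rows); (ii) `Φ.step ↦ Φ.qstep` with the called Steps lemma replaced by its `…Q`/`_q` twin and the cost `Φ.M` threaded (none in this file unless
listed below); (iii) `Φ.cyl_connected ↦ Φ.cyl_reach` readers (none unless listed); (iv) graph-ball radii / window floors ×`Φ.M` (none unless listed).  HAND HUNK (L-KitS-1 / L-FLOORMAP-1 ⑧): the bridge index, clearance and core rows read the kit's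
R′ at the window cost of record — `KS0.R'0 κ Φ t p D mk ↦ KS0.R'0N κ Φ (KS.NQ Φ) t p D mk` (stmt-g33's G017 «SkelFrmQuasiBChoiceNums», hp-8's «SkelFrmQuasiBParamsKitSN»).  Carrier-free
residents stay imported/exported from the original «SkelFrmBParamsBridge0» exactly as in the FrmFrom port.  Docstrings and citations are the original's.

-/

noncomputable section

open scoped Classical

namespace Summit.CriticalPhenomena.PercolationContinuityZ3.Theorems.Transplant

namespace PlanarSkeletonFrmQuasi

namespace NegB

-- GEN-Q residents of the row-less «SkelFrmFromBParamsB» read below and not re-exported by the imported parents (design owner p3-g30, L-cone-2 / T3):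
export PlanarSkeletonFrmFrom.NegB (vB MB_facts nB_facts ℓB_ge)

open Literature.Probability.Percolation Literature.Probability.LatticeModels SimpleGraph
open SkelConc (Consts)
open Skelφ (rootFrame pgSideHalfW)
open Skelφ.StepI (DataN)
open ChainPlanar (BridgePrm BridgeOK)
open Neg

namespace KS

/-! ## §1 The root bridge pair -/

section Pair

variable (κ : Consts) {V : Type} [DecidableEq V] [Countable V] {G : SimpleGraph V} [G.LocallyFinite] (Φ : PlanarSkeletonFrmQuasi G) (t : V) (p : unitInterval)
  (D : Skelφ.StepI.DataNS V) (mk : ℕ)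

/-- **The root bridge clearance** `b0 := Rs + 2·R'0 + 2` ((R-41)(a): `(g, f)`-free). [this work] -/
def b0 (κ : Consts) {V : Type} [DecidableEq V] [Countable V] {G : SimpleGraph V} [G.LocallyFinite] (Φ : PlanarSkeletonFrmQuasi G) (t : V) (p : unitInterval) (D : Skelφ.StepI.DataNS V) (mk : ℕ) : ℕ := KS.Rs t D mk + 2 * KS0.R'0N κ Φ (KS.NQ Φ) t p D mk + 2

/-- **The root bridge zone-index floor** `mb0 := max (2·b0 + 26) (24·M_u + 63)`. [this work] -/
def mb0 (κ : Consts) {V : Type} [DecidableEq V] [Countable V] {G : SimpleGraph V} [G.LocallyFinite] (Φ : PlanarSkeletonFrmQuasi G) (t : V) (p : unitInterval) (D : Skelφ.StepI.DataNS V) (mk : ℕ) : ℕ := max (2 * b0 κ Φ t p D mk + 26) (24 * Mu D + 63)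

/-- The root bridge zone index `MB0 := MB D mb0` (a SELECTED zone size). [this work] -/
abbrev MB0 (κ : Consts) {V : Type} [DecidableEq V] [Countable V] {G : SimpleGraph V} [G.LocallyFinite] (Φ : PlanarSkeletonFrmQuasi G) (t : V) (p : unitInterval) (D : Skelφ.StepI.DataNS V) (mk : ℕ) : ℕ := MB D (mb0 κ Φ t p D mk)

/-- The root bridge width `nB0 := nB D mb0 b0` (a SELECTED width). [this work] -/
abbrev nB0 (κ : Consts) {V : Type} [DecidableEq V] [Countable V] {G : SimpleGraph V} [G.LocallyFinite] (Φ : PlanarSkeletonFrmQuasi G) (t : V) (p : unitInterval) (D : Skelφ.StepI.DataNS V) (mk : ℕ) : ℕ := nB D (mb0 κ Φ t p D mk) (b0 κ Φ t p D mk)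

/-- The root bridge shear `hB0`. [this work] -/
abbrev hB0 (κ : Consts) {V : Type} [DecidableEq V] [Countable V] {G : SimpleGraph V} [G.LocallyFinite] (Φ : PlanarSkeletonFrmQuasi G) (t : V) (p : unitInterval) (D : Skelφ.StepI.DataNS V) (mk : ℕ) : ℤ := hB t D (mb0 κ Φ t p D mk) (b0 κ Φ t p D mk)

/-- The root bridge half-length `ℓB0`. [this work] -/
abbrev ℓB0 (κ : Consts) {V : Type} [DecidableEq V] [Countable V] {G : SimpleGraph V} [G.LocallyFinite] (Φ : PlanarSkeletonFrmQuasi G) (t : V) (p : unitInterval) (D : Skelφ.StepI.DataNS V) (mk : ℕ) : ℕ := ℓB t D (mb0 κ Φ t p D mk) (b0 κ Φ t p D mk)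

/-- The root bridge split point `vB0`. [this work] -/
abbrev vB0 (κ : Consts) {V : Type} [DecidableEq V] [Countable V] {G : SimpleGraph V} [G.LocallyFinite] (Φ : PlanarSkeletonFrmQuasi G) (t : V) (p : unitInterval) (D : Skelφ.StepI.DataNS V) (mk : ℕ) : ℤ := vB t D (mb0 κ Φ t p D mk) (b0 κ Φ t p D mk)

/-- **The root bridge prism's planar radius** `prB0 := pgScale nB0 hB0 (3·ℓB0)` (= the record's link-region scale at the pair). [this work] -/
def prB0 (κ : Consts) {V : Type} [DecidableEq V] [Countable V] {G : SimpleGraph V} [G.LocallyFinite] (Φ : PlanarSkeletonFrmQuasi G) (t : V) (p : unitInterval) (D : Skelφ.StepI.DataNS V) (mk : ℕ) : ℕ := Skelφ.pgScale (nB0 κ Φ t p D mk) (hB0 κ Φ t p D mk) (3 * ℓB0 κ Φ t p D mk)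

/-- **The root bridge prism's fibre radius** `RB0 := D.R prB0` (the `Rb` of the skeletons). [this work] -/
def RB0 (κ : Consts) {V : Type} [DecidableEq V] [Countable V] {G : SimpleGraph V} [G.LocallyFinite] (Φ : PlanarSkeletonFrmQuasi G) (t : V) (p : unitInterval) (D : Skelφ.StepI.DataNS V) (mk : ℕ) : ℕ := D.R (prB0 κ Φ t p D mk)

/-- `b0 = Rs + 2R'0 + 2`. [folklore] -/
theorem b0_eq (κ : Consts) {V : Type} [DecidableEq V] [Countable V] {G : SimpleGraph V} [G.LocallyFinite] (Φ : PlanarSkeletonFrmQuasi G) (t : V) (p : unitInterval) (D : Skelφ.StepI.DataNS V) (mk : ℕ) : b0 κ Φ t p D mk = KS.Rs t D mk + 2 * KS0.R'0N κ Φ (KS.NQ Φ) t p D mk + 2 := rfl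

/-- `2·b0 + 26 ≤ mb0` and `24·M_u + 63 ≤ mb0`. [folklore] -/
theorem mb0_floors (κ : Consts) {V : Type} [DecidableEq V] [Countable V] {G : SimpleGraph V} [G.LocallyFinite] (Φ : PlanarSkeletonFrmQuasi G) (t : V) (p : unitInterval) (D : Skelφ.StepI.DataNS V) (mk : ℕ) : 2 * b0 κ Φ t p D mk + 26 ≤ mb0 κ Φ t p D mk ∧ 24 * Mu D + 63 ≤ mb0 κ Φ t p D mk := ⟨le_max_left _ _, le_max_right _ _⟩

/-- **(R-F2) at the root bridge**: `b0 ≤ nB0`, `MB0 < nB0`, `MB0 + b0 + 2 + ρz ≤ nB0`. [folklore] -/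
theorem RF2_0 (κ : Consts) {V : Type} [DecidableEq V] [Countable V] {G : SimpleGraph V} [G.LocallyFinite] (Φ : PlanarSkeletonFrmQuasi G) (t : V) (p : unitInterval) (D : Skelφ.StepI.DataNS V) (mk : ℕ) : b0 κ Φ t p D mk ≤ nB0 κ Φ t p D mk ∧ MB0 κ Φ t p D mk < nB0 κ Φ t p D mk ∧ MB0 κ Φ t p D mk + b0 κ Φ t p D mk + 2 + ρz D ≤ nB0 κ Φ t p D mk :=
  ⟨(nB_facts D _ _).2.2.1, (nB_facts D _ _).2.1, (nB_facts D _ _).2.2.2⟩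

/-- **The zone-index floors at the root bridge**: `2·b0 + 26 ≤ MB0`, `24·M_u + 63 ≤ MB0`, `M_u ≤ MB0`. [folklore] -/
theorem MB0_floors (κ : Consts) {V : Type} [DecidableEq V] [Countable V] {G : SimpleGraph V} [G.LocallyFinite] (Φ : PlanarSkeletonFrmQuasi G) (t : V) (p : unitInterval) (D : Skelφ.StepI.DataNS V) (mk : ℕ) : 2 * b0 κ Φ t p D mk + 26 ≤ MB0 κ Φ t p D mk ∧ 24 * Mu D + 63 ≤ MB0 κ Φ t p D mk ∧ Mu D ≤ MB0 κ Φ t p D mk := by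
  have h1 := (MB_facts D (mb0 κ Φ t p D mk)).2.1
  have h2 := mb0_floors κ Φ t p D mk
  exact ⟨h2.1.trans h1, h2.2.trans h1, (MB_facts D _).1⟩

/-- **The root bridge pair is admissible.** [folklore] -/
theorem bridge0_adm (κ : Consts) {V : Type} [DecidableEq V] [Countable V] {G : SimpleGraph V} [G.LocallyFinite] (Φ : PlanarSkeletonFrmQuasi G) (t : V) (p : unitInterval) (D : Skelφ.StepI.DataNS V) (mk : ℕ) : D.M₀ ≤ (MB0 κ Φ t p D mk, nB0 κ Φ t p D mk).1 ∧ D.n₁ (MB0 κ Φ t p D mk, nB0 κ Φ t p D mk).1 ≤ (MB0 κ Φ t p D mk, nB0 κ Φ t p D mk).2 :=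
  bridge_adm D _ _

-- GEN-Q (R-2, captain 2026-08-27): `PlanarSkeletonFrmFrom.NegB.KS.bridge0_pair_eq` is not in the used cone of the node top — not ported.

/-- **`2·b0 + 27 ≤ ℓB0`** from the pair's geometric clause (any map `ψ`); in particular `3 ≤ ℓB0` and `27 ≤ ℓB0`. [folklore] -/
theorem ℓB0_ge (κ : Consts) {V : Type} [DecidableEq V] [Countable V] {G : SimpleGraph V} [G.LocallyFinite] (Φ : PlanarSkeletonFrmQuasi G) (t : V) (p : unitInterval) (D : Skelφ.StepI.DataNS V) (mk : ℕ) (ψ : V → Site 2) (hE : D.EqGeom G ψ t (MB0 κ Φ t p D mk) (nB0 κ Φ t p D mk)) : 2 * b0 κ Φ t p D mk + 27 ≤ ℓB0 κ Φ t p D mk := by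
  have h1 := ℓB_ge t D (mb0 κ Φ t p D mk) (b0 κ Φ t p D mk) ψ hE
  have h2 := (mb0_floors κ Φ t p D mk).1
  show _ ≤ ℓB t D (mb0 κ Φ t p D mk) (b0 κ Φ t p D mk)
  omega

/-- `nB0 ≤ prB0` and `3·ℓB0 + |hB0| ≤ prB0`. [folklore] -/
theorem le_prB0 (κ : Consts) {V : Type} [DecidableEq V] [Countable V] {G : SimpleGraph V} [G.LocallyFinite] (Φ : PlanarSkeletonFrmQuasi G) (t : V) (p : unitInterval) (D : Skelφ.StepI.DataNS V) (mk : ℕ) : nB0 κ Φ t p D mk ≤ prB0 κ Φ t p D mk ∧ 3 * ℓB0 κ Φ t p D mk + (hB0 κ Φ t p D mk).natAbs ≤ prB0 κ Φ t p D mk :=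
  ⟨le_max_left _ _, le_max_right _ _⟩

-- GEN-Q (R-2, captain 2026-08-27): `PlanarSkeletonFrmFrom.NegB.KS.prB0_eq_scale` is not in the used cone of the node top — not ported.

-- GEN-Q (R-2, captain 2026-08-27): `PlanarSkeletonFrmFrom.NegB.KS.RB0_eq` is not in the used cone of the node top — not ported.

/-- **The width residual the root bridge asks** `fxR0 := Rs + R'0 + prB0 + 1` (floor on the long pair's width slot `f`; (g, f)-free). [this work] -/
def fxR0 (κ : Consts) {V : Type} [DecidableEq V] [Countable V] {G : SimpleGraph V} [G.LocallyFinite] (Φ : PlanarSkeletonFrmQuasi G) (t : V) (p : unitInterval) (D : Skelφ.StepI.DataNS V) (mk : ℕ) : ℕ := KS.Rs t D mk + KS0.R'0N κ Φ (KS.NQ Φ) t p D mk + prB0 κ Φ t p D mk + 1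

/-- `fxR0` unfolded. [folklore] -/
theorem fxR0_eq (κ : Consts) {V : Type} [DecidableEq V] [Countable V] {G : SimpleGraph V} [G.LocallyFinite] (Φ : PlanarSkeletonFrmQuasi G) (t : V) (p : unitInterval) (D : Skelφ.StepI.DataNS V) (mk : ℕ) : fxR0 κ Φ t p D mk = KS.Rs t D mk + KS0.R'0N κ Φ (KS.NQ Φ) t p D mk + prB0 κ Φ t p D mk + 1 := rfl

end Pair

/-- **THE EXTRA-PAIR SLOT CARRYING THE ROOT BRIDGE** `Px0 mk := {(MB0, nB0)}` (with admissibility); stmt-g21 unions it into the node tuple's `PxQ`. [this work] -/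
def Px0 (mk : ℕ) : PSlot := fun κ _ _ _ _ _ Φ t p D =>
  ⟨{(MB0 κ Φ t p D mk, nB0 κ Φ t p D mk)}, fun q hq => by rw [Finset.mem_singleton] at hq; subst hq; exact bridge0_adm κ Φ t p D mk⟩

section Slot

variable (κ : Consts) {V : Type} [DecidableEq V] [Countable V] {G : SimpleGraph V} [G.LocallyFinite] (Φ : PlanarSkeletonFrmQuasi G) (t : V) (p : unitInterval)
  (D : Skelφ.StepI.DataNS V) (mk : ℕ)

/-- The root bridge pair is in its own slot. [folklore] -/
theorem mem_Px0 (κ : Consts) {V : Type} [DecidableEq V] [Countable V] {G : SimpleGraph V} [G.LocallyFinite] (Φ : PlanarSkeletonFrmQuasi G) (t : V) (p : unitInterval) (D : Skelφ.StepI.DataNS V) (mk : ℕ) : (MB0 κ Φ t p D mk, nB0 κ Φ t p D mk) ∈ (Px0 mk κ Φ t p D).1 := Finset.mem_singleton_self _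

/-- The root bridge pair is in every pair slot containing `Px0 mk`'s pairs (the node tuple's `Pv ⊇ Px0 ∪ …`). [folklore] -/
theorem mem_of_Px0_subset (κ : Consts) {V : Type} [DecidableEq V] [Countable V] {G : SimpleGraph V} [G.LocallyFinite] (Φ : PlanarSkeletonFrmQuasi G) (t : V) (p : unitInterval) (D : Skelφ.StepI.DataNS V) (mk : ℕ) (Pv : PSlot) (h : (Px0 mk κ Φ t p D).1 ⊆ (Pv κ Φ t p D).1) : (MB0 κ Φ t p D mk, nB0 κ Φ t p D mk) ∈ (Pv κ Φ t p D).1 :=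
  h (mem_Px0 κ Φ t p D mk)

-- GEN-Q (R-2, captain 2026-08-27): `PlanarSkeletonFrmFrom.NegB.KS.mem_PR_of_Px0_subset` is not in the used cone of the node top — not ported.

end Slot

/-! ## §2 The root bridge frame (`σ = 1`, case `o_b = o_L` — the only case, (R-41)(b)) -/

section Frame

variable (κ : Consts) {V : Type} [DecidableEq V] [Countable V] {G : SimpleGraph V} [G.LocallyFinite] (Φ : PlanarSkeletonFrmQuasi G) (t : V) (p : unitInterval)
  (D : Skelφ.StepI.DataNS V) (mk : ℕ) (g f : ℕ)

/-- **THE ROOT BRIDGE FRAME** `B0 mk g f := bridgeSame 1 n_L h_L ℓ_L (R'0 mk) nB0 hB0 ℓB0`: hop box `B₀ = {n_L} × [h_L, h_L + ℓ_L]`, siting radius `R'0`, stride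
displacement `{nB0} × [hB0, hB0 + ℓB0]`, prism bound `prB0`. [this work] -/
def B0 (κ : Consts) {V : Type} [DecidableEq V] [Countable V] {G : SimpleGraph V} [G.LocallyFinite] (Φ : PlanarSkeletonFrmQuasi G) (t : V) (p : unitInterval) (D : Skelφ.StepI.DataNS V) (mk : ℕ) (g : ℕ) (f : ℕ) : BridgePrm :=
  Skelφ.bridgeSame 1 (nL κ Φ t p D g f) (hL κ Φ t p D g f) (ℓL κ Φ t p D g f) (KS0.R'0N κ Φ (KS.NQ Φ) t p D mk) (nB0 κ Φ t p D mk) (hB0 κ Φ t p D mk) (ℓB0 κ Φ t p D mk)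

-- GEN-Q (R-2, captain 2026-08-27): `PlanarSkeletonFrmFrom.NegB.KS.B0_eq` is not in the used cone of the node top — not ported.

/-- **The six fields of `B0`** (coordinatewise): `B₀lo = (n_L, h_L)`, `B₀hi = (n_L, h_L + ℓ_L)`, `R′ = R'0`, `dlo = (nB0, hB0)`, `dhi = (nB0, hB0 + ℓB0)`, `pr = prB0`. [folklore] -/
theorem B0_apply (κ : Consts) {V : Type} [DecidableEq V] [Countable V] {G : SimpleGraph V} [G.LocallyFinite] (Φ : PlanarSkeletonFrmQuasi G) (t : V) (p : unitInterval) (D : Skelφ.StepI.DataNS V) (mk : ℕ) (g : ℕ) (f : ℕ) : (B0 κ Φ t p D mk g f).B₀lo 0 = nL κ Φ t p D g f ∧ (B0 κ Φ t p D mk g f).B₀lo 1 = hL κ Φ t p D g f ∧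
    (B0 κ Φ t p D mk g f).B₀hi 0 = nL κ Φ t p D g f ∧ (B0 κ Φ t p D mk g f).B₀hi 1 = hL κ Φ t p D g f + ℓL κ Φ t p D g f ∧
    (B0 κ Φ t p D mk g f).R' = KS0.R'0N κ Φ (KS.NQ Φ) t p D mk ∧
    (B0 κ Φ t p D mk g f).dlo 0 = nB0 κ Φ t p D mk ∧ (B0 κ Φ t p D mk g f).dlo 1 = hB0 κ Φ t p D mk ∧
    (B0 κ Φ t p D mk g f).dhi 0 = nB0 κ Φ t p D mk ∧ (B0 κ Φ t p D mk g f).dhi 1 = hB0 κ Φ t p D mk + ℓB0 κ Φ t p D mk ∧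
    (B0 κ Φ t p D mk g f).pr = prB0 κ Φ t p D mk := by
  refine ⟨?_, ?_, ?_, ?_, rfl, ?_, ?_, ?_, ?_, rfl⟩ <;> simp [B0, Skelφ.bridgeSame]

/-- **`hB`**: `B0` is admissible (`3 ≤ ℓB0`). [folklore] -/
theorem B0_ok (κ : Consts) {V : Type} [DecidableEq V] [Countable V] {G : SimpleGraph V} [G.LocallyFinite] (Φ : PlanarSkeletonFrmQuasi G) (t : V) (p : unitInterval) (D : Skelφ.StepI.DataNS V) (mk : ℕ) (g : ℕ) (f : ℕ) (hℓ : 3 ≤ ℓB0 κ Φ t p D mk) : BridgeOK (B0 κ Φ t p D mk g f) :=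
  (Skelφ.bridgeOK_all (σ := 1) (Or.inl rfl) _ _ _ _ _ _ hℓ).1

/-- **`hB0`**: the hop box is nonempty, `B₀lo ≤ B₀hi`. [folklore] -/
theorem B0_lo_le_hi (κ : Consts) {V : Type} [DecidableEq V] [Countable V] {G : SimpleGraph V} [G.LocallyFinite] (Φ : PlanarSkeletonFrmQuasi G) (t : V) (p : unitInterval) (D : Skelφ.StepI.DataNS V) (mk : ℕ) (g : ℕ) (f : ℕ) : (B0 κ Φ t p D mk g f).B₀lo ≤ (B0 κ Φ t p D mk g f).B₀hi := by
  obtain ⟨e0, e1, e2, e3, -⟩ := B0_apply κ Φ t p D mk g f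
  intro i
  fin_cases i
  · show (B0 κ Φ t p D mk g f).B₀lo 0 ≤ (B0 κ Φ t p D mk g f).B₀hi 0
    rw [e0, e2]
  · show (B0 κ Φ t p D mk g f).B₀lo 1 ≤ (B0 κ Φ t p D mk g f).B₀hi 1
    rw [e1, e3]
    have : (0 : ℤ) ≤ (ℓL κ Φ t p D g f : ℤ) := by positivity
    linarith

/-- **`hBR'`**: `R'0 ≤ B0.R′` (equality). [folklore] -/
theorem R'0_le_B0_R' (κ : Consts) {V : Type} [DecidableEq V] [Countable V] {G : SimpleGraph V} [G.LocallyFinite] (Φ : PlanarSkeletonFrmQuasi G) (t : V) (p : unitInterval) (D : Skelφ.StepI.DataNS V) (mk : ℕ) (g : ℕ) (f : ℕ) : KS0.R'0N κ Φ (KS.NQ Φ) t p D mk ≤ (B0 κ Φ t p D mk g f).R' := le_rfl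

/-- **`hc1`**: the core-`1` box is nonempty (`3 ≤ ℓB0`). [folklore] -/
theorem B0_core1_le (κ : Consts) {V : Type} [DecidableEq V] [Countable V] {G : SimpleGraph V} [G.LocallyFinite] (Φ : PlanarSkeletonFrmQuasi G) (t : V) (p : unitInterval) (D : Skelφ.StepI.DataNS V) (mk : ℕ) (g : ℕ) (f : ℕ) (hℓ : 3 ≤ ℓB0 κ Φ t p D mk) : (B0 κ Φ t p D mk g f).core1Lo ≤ (B0 κ Φ t p D mk g f).core1Hi :=
  ChainPlanar.BridgePrm.core1Lo_le_core1Hi (B0_ok κ Φ t p D mk g f hℓ)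

/-- **The core-`1` box in closed form**: `core1Lo = (n_L − R'0 + nB0, h_L − R'0 + hB0)`, `core1Hi = (n_L + R'0 + nB0, h_L + ℓ_L + R'0 + hB0 + ℓB0)`. [folklore] -/
theorem B0_core1 (κ : Consts) {V : Type} [DecidableEq V] [Countable V] {G : SimpleGraph V} [G.LocallyFinite] (Φ : PlanarSkeletonFrmQuasi G) (t : V) (p : unitInterval) (D : Skelφ.StepI.DataNS V) (mk : ℕ) (g : ℕ) (f : ℕ) : (B0 κ Φ t p D mk g f).core1Lo 0 = (nL κ Φ t p D g f : ℤ) - KS0.R'0N κ Φ (KS.NQ Φ) t p D mk + nB0 κ Φ t p D mk ∧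
    (B0 κ Φ t p D mk g f).core1Lo 1 = hL κ Φ t p D g f - KS0.R'0N κ Φ (KS.NQ Φ) t p D mk + hB0 κ Φ t p D mk ∧
    (B0 κ Φ t p D mk g f).core1Hi 0 = (nL κ Φ t p D g f : ℤ) + KS0.R'0N κ Φ (KS.NQ Φ) t p D mk + nB0 κ Φ t p D mk ∧
    (B0 κ Φ t p D mk g f).core1Hi 1 = hL κ Φ t p D g f + ℓL κ Φ t p D g f + KS0.R'0N κ Φ (KS.NQ Φ) t p D mk + (hB0 κ Φ t p D mk + ℓB0 κ Φ t p D mk) := by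
  obtain ⟨e0, e1, e2, e3, eR, d0, d1, d2, d3, -⟩ := B0_apply κ Φ t p D mk g f
  refine ⟨?_, ?_, ?_, ?_⟩
  · simp only [ChainPlanar.BridgePrm.core1Lo_apply, e0, eR, d0]
  · simp only [ChainPlanar.BridgePrm.core1Lo_apply, e1, eR, d1]
  · simp only [ChainPlanar.BridgePrm.core1Hi_apply, e2, eR, d2]
  · simp only [ChainPlanar.BridgePrm.core1Hi_apply, e3, eR, d3, add_assoc]

/-- **`hhopB`**: THE HOP'S SIDE HALF LANDS IN `B₀` — for ANY planar map `φ` and kit radius `R`, the side half `pgSideHalfW G φ t n_L h_L ℓ_L R 1 1` read in the root frame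
`rootFrame φ t 1` lies in `[B₀lo, B₀hi] = {n_L} × [h_L, h_L + ℓ_L]` (`1 ≤ n_L`). [cite: MartineauTassion2017, §3.2 (L(a,u), L(u,b))] -/
theorem hhopB_0 (κ : Consts) {V : Type} [DecidableEq V] [Countable V] {G : SimpleGraph V} [G.LocallyFinite] (Φ : PlanarSkeletonFrmQuasi G) (t : V) (p : unitInterval) (D : Skelφ.StepI.DataNS V) (mk : ℕ) (g : ℕ) (f : ℕ) (φ : V → Site 2) (R : ℕ) (hn : 1 ≤ nL κ Φ t p D g f) :
    ∀ w ∈ pgSideHalfW G φ t (nL κ Φ t p D g f) (hL κ Φ t p D g f) (ℓL κ Φ t p D g f) R 1 (1 * 1),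
      rootFrame φ t 1 w ∈ Finset.Icc (B0 κ Φ t p D mk g f).B₀lo (B0 κ Φ t p D mk g f).B₀hi := by
  intro w hw
  rw [one_mul] at hw
  have h := Skelφ.rootFrame_mem_box_of_sideHalf (G := G) (φ := φ) t (σ := 1) hn (Or.inl rfl) hw
  have h0 : rootFrame φ t 1 t = 0 := by funext i; fin_cases i <;> simp [Skelφ.rootFrame]
  have hℓ0 : (0 : ℤ) ≤ (ℓL κ Φ t p D g f : ℤ) := by positivity
  simp only [h0, zero_add, one_mul, min_eq_left hℓ0, max_eq_right hℓ0, add_zero] at h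
  have elo : (B0 κ Φ t p D mk g f).B₀lo = Skelφ.pt (nL κ Φ t p D g f : ℤ) (hL κ Φ t p D g f) := by
    show Skelφ.pt _ (1 * hL κ Φ t p D g f) = _; rw [one_mul]
  have ehi : (B0 κ Φ t p D mk g f).B₀hi = Skelφ.pt (nL κ Φ t p D g f : ℤ) (hL κ Φ t p D g f + ℓL κ Φ t p D g f) := by
    show Skelφ.pt _ (1 * hL κ Φ t p D g f + _) = _; rw [one_mul]
  rw [elo, ehi]
  exact h

/-- **`hclear₁`** (= (R-F1): the bridge step's region clears the seed): `Rs < B₀lo 0 − R′ − pr = n_L − R'0 − prB0`, under the width floor `fxR0 ≤ n_L`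
(served as `fxR0 ≤ f ≤ n_L g f`). [folklore] -/
theorem hclear₁_0 (κ : Consts) {V : Type} [DecidableEq V] [Countable V] {G : SimpleGraph V} [G.LocallyFinite] (Φ : PlanarSkeletonFrmQuasi G) (t : V) (p : unitInterval) (D : Skelφ.StepI.DataNS V) (mk : ℕ) (g : ℕ) (f : ℕ) (hf : fxR0 κ Φ t p D mk ≤ nL κ Φ t p D g f) :
    ((KS.Rs t D mk : ℕ) : ℤ) < (B0 κ Φ t p D mk g f).B₀lo 0 - (B0 κ Φ t p D mk g f).R' - (B0 κ Φ t p D mk g f).pr := by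
  obtain ⟨e0, -, -, -, eR, -, -, -, -, epr⟩ := B0_apply κ Φ t p D mk g f
  rw [e0, eR, epr]
  rw [fxR0_eq] at hf
  have h : ((KS.Rs t D mk + KS0.R'0N κ Φ (KS.NQ Φ) t p D mk + prB0 κ Φ t p D mk + 1 : ℕ) : ℤ) ≤ (nL κ Φ t p D g f : ℤ) := by exact_mod_cast hf
  push_cast at h
  linarith

/-- `hclear₁` from the slot floor `fxR0 ≤ f` (`f ≤ n_L g f` always). [folklore] -/
theorem hclear₁_0_of_floor (κ : Consts) {V : Type} [DecidableEq V] [Countable V] {G : SimpleGraph V} [G.LocallyFinite] (Φ : PlanarSkeletonFrmQuasi G) (t : V) (p : unitInterval) (D : Skelφ.StepI.DataNS V) (mk : ℕ) (g : ℕ) (f : ℕ) (hf : fxR0 κ Φ t p D mk ≤ f) :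
    ((KS.Rs t D mk : ℕ) : ℤ) < (B0 κ Φ t p D mk g f).B₀lo 0 - (B0 κ Φ t p D mk g f).R' - (B0 κ Φ t p D mk g f).pr :=
  hclear₁_0 κ Φ t p D mk g f (hf.trans (n₁L_le_nL κ Φ t p D g f).2)

/-- **The core-`1` reach budget** `Yb0 := n_L + |h_L| + 2·R'0 + nB0 + |hB0|` (≥ `‖core1Lo‖₁`; the skeleton's `hc1R` becomes the floor `Yb0 ≤ Rπ`). [this work] -/
def Yb0 (κ : Consts) {V : Type} [DecidableEq V] [Countable V] {G : SimpleGraph V} [G.LocallyFinite] (Φ : PlanarSkeletonFrmQuasi G) (t : V) (p : unitInterval) (D : Skelφ.StepI.DataNS V) (mk : ℕ) (g : ℕ) (f : ℕ) : ℕ := nL κ Φ t p D g f + (hL κ Φ t p D g f).natAbs + 2 * KS0.R'0N κ Φ (KS.NQ Φ) t p D mk + nB0 κ Φ t p D mk + (hB0 κ Φ t p D mk).natAbs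

/-- **`‖core1Lo‖₁ ≤ Yb0`.** [folklore] -/
theorem core1Lo_0_l1 (κ : Consts) {V : Type} [DecidableEq V] [Countable V] {G : SimpleGraph V} [G.LocallyFinite] (Φ : PlanarSkeletonFrmQuasi G) (t : V) (p : unitInterval) (D : Skelφ.StepI.DataNS V) (mk : ℕ) (g : ℕ) (f : ℕ) : ((B0 κ Φ t p D mk g f).core1Lo 0).natAbs + ((B0 κ Φ t p D mk g f).core1Lo 1).natAbs ≤ Yb0 κ Φ t p D mk g f := by
  obtain ⟨c0, c1, -, -⟩ := B0_core1 κ Φ t p D mk g f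
  have key : ∀ a b : ℤ, |a| + |b| ≤ (Yb0 κ Φ t p D mk g f : ℤ) → a.natAbs + b.natAbs ≤ Yb0 κ Φ t p D mk g f := fun a b h => by
    have : ((a.natAbs + b.natAbs : ℕ) : ℤ) ≤ (Yb0 κ Φ t p D mk g f : ℤ) := by push_cast [Int.natCast_natAbs]; exact h
    exact_mod_cast this
  refine key _ _ ?_
  rw [c0, c1]
  have hY : (Yb0 κ Φ t p D mk g f : ℤ) = (nL κ Φ t p D g f : ℤ) + |hL κ Φ t p D g f| + 2 * KS0.R'0N κ Φ (KS.NQ Φ) t p D mk + nB0 κ Φ t p D mk + |hB0 κ Φ t p D mk| := by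
    unfold Yb0; push_cast [Int.natCast_natAbs]; ring
  rw [hY]
  have hn : (0 : ℤ) ≤ (nL κ Φ t p D g f : ℤ) := by positivity
  have hR : (0 : ℤ) ≤ (KS0.R'0N κ Φ (KS.NQ Φ) t p D mk : ℤ) := by positivity
  have hb : (0 : ℤ) ≤ (nB0 κ Φ t p D mk : ℤ) := by positivity
  have h1 : |(nL κ Φ t p D g f : ℤ) - KS0.R'0N κ Φ (KS.NQ Φ) t p D mk + nB0 κ Φ t p D mk| ≤ (nL κ Φ t p D g f : ℤ) + KS0.R'0N κ Φ (KS.NQ Φ) t p D mk + nB0 κ Φ t p D mk :=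
    abs_le.2 ⟨by linarith, by linarith⟩
  have h2 : |hL κ Φ t p D g f - KS0.R'0N κ Φ (KS.NQ Φ) t p D mk + hB0 κ Φ t p D mk| ≤ |hL κ Φ t p D g f| + KS0.R'0N κ Φ (KS.NQ Φ) t p D mk + |hB0 κ Φ t p D mk| := by
    have a1 := le_abs_self (hL κ Φ t p D g f)
    have a2 := neg_abs_le (hL κ Φ t p D g f)
    have a3 := le_abs_self (hB0 κ Φ t p D mk)
    have a4 := neg_abs_le (hB0 κ Φ t p D mk)
    exact abs_le.2 ⟨by linarith, by linarith⟩
  linarith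

/-- **(R-F2′) in the numbers**: `core1Lo 0 = n_L − R'0 + nB0 ≥ Rs + n_L + R'0 + 2` (from `b0 ≤ nB0`). [folklore] -/
theorem core1Lo_0_ge (κ : Consts) {V : Type} [DecidableEq V] [Countable V] {G : SimpleGraph V} [G.LocallyFinite] (Φ : PlanarSkeletonFrmQuasi G) (t : V) (p : unitInterval) (D : Skelφ.StepI.DataNS V) (mk : ℕ) (g : ℕ) (f : ℕ) : ((KS.Rs t D mk : ℕ) : ℤ) + nL κ Φ t p D g f + KS0.R'0N κ Φ (KS.NQ Φ) t p D mk + 2 ≤ (B0 κ Φ t p D mk g f).core1Lo 0 := by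
  obtain ⟨c0, -, -, -⟩ := B0_core1 κ Φ t p D mk g f
  rw [c0]
  have h := (RF2_0 κ Φ t p D mk).1
  rw [b0_eq] at h
  have h' : ((KS.Rs t D mk + 2 * KS0.R'0N κ Φ (KS.NQ Φ) t p D mk + 2 : ℕ) : ℤ) ≤ (nB0 κ Φ t p D mk : ℤ) := by exact_mod_cast h
  push_cast at h'
  linarith

end Frame

end KS

end NegB

end PlanarSkeletonFrmQuasi

end Summit.CriticalPhenomena.PercolationContinuityZ3.Theorems.Transplant

end
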